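import Mathlib
import Summits.Ventures.HodgeRepro.Tier4.Line1.TorusBlockScalar

/-!
# Tier4/Line1/TorusElement — the torus elements `S⁻¹ᵀ · blockScalar(ρ)ᵀ · Sᵀ` (row picture) and their algebra

Blind re-derivation cell `pub-hodge-repro`, Tier 4 (README §9–§10), seat t4-L1-p5 (prover, LINE L1, gen 2).
`TorusData k` bundles the rational data of a torus bridge (a symmetric `B`, `Om` with `Om² = −d`, the hermitian
relation, anisotropy, a projector `P` onto the `E′`-line of `v` along the `E′`-line of `w`, the two lines orthogonal);
for such data and a commutative `k`-algebra `R` through `ι`, `tmat ι D ρ` is the ROW-convention matrix of the pair of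
scalars `ρ = (x, y, x′, y′)` — `ρ` acting as `x + y√−d` on the line of `v` and `x′ + y′√−d` on the line of `w` —
i.e. the transpose of `S · blockScalar · S⁻¹` of `TorusBlockScalar`.  Lemmas: multiplicativity (`tmat_mul`, the
componentwise product of `R[√−d]²`), the unit, the inverse `tmat (ρ̄)` for norm-one `ρ`, commutation with `Omᵀ` and
`Pᵀ`, the isometry identity `tmat B tmatᵀ = B` for norm-one `ρ`, and transport along ring homomorphisms.  With
`torus_scalar_of_isometry` this says: an element of the torus IS `tmat` of its pair of scalars.  Mathlib + the
line's modules only.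

Nothing here says anything about the status of the Hodge conjecture for CM abelian varieties, which is NOT proved
(HC_CM is NOT proved by anyone in this repository).
-/

set_option autoImplicit false

noncomputable section

namespace Summit.Ventures.HodgeRepro.Tier4.Line1.Rot

open Matrix

/-- **the rational data of a torus bridge** (column picture): `B` symmetric, `Om` with `Om² = −d` and
`Omᵀ B = −B Om`, `−d` not a square, `B` anisotropic, two non-zero vectors `v, w` spanning orthogonal `E′`-lines,
and a projector `P` fixing the line of `v` and killing the line of `w`. -/
structure TorusData (k : Type) [Field k] where
  /-- the symmetric bilinear form -/
  B : Matrix (Fin 4) (Fin 4) k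
  /-- the complex structure `Om`, `Om² = −d` -/
  Om : Matrix (Fin 4) (Fin 4) k
  /-- the projector onto the line of `v` along the line of `w` -/
  P : Matrix (Fin 4) (Fin 4) k
  /-- the discriminant: `Om² = −d` -/
  d : k
  /-- a non-zero vector of the first line -/
  v : Fin 4 → k
  /-- a non-zero vector of the second line -/
  w : Fin 4 → k
  /-- `B` is symmetric -/
  hB : Bᵀ = B
  /-- the hermitian relation -/
  hherm : Omᵀ * B = -(B * Om)
  /-- `Om² = −d` -/
  hOm : Om * Om = -(d • (1 : Matrix (Fin 4) (Fin 4) k))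
  /-- `−d` is not a square -/
  hd : ¬ IsSquare (-d)
  /-- anisotropy -/
  hdef : ∀ u : Fin 4 → k, u ≠ 0 → u ⬝ᵥ (B *ᵥ u) ≠ 0
  /-- `v ≠ 0` -/
  hv : v ≠ 0
  /-- `w ≠ 0` -/
  hw : w ≠ 0
  /-- `w ⊥ v` -/
  hwv : w ⬝ᵥ (B *ᵥ v) = 0
  /-- `w ⊥ Om v` -/
  hwOv : w ⬝ᵥ (B *ᵥ (Om *ᵥ v)) = 0
  /-- `P v = v` -/
  hPv : P *ᵥ v = v
  /-- `P (Om v) = Om v` -/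
  hPOv : P *ᵥ (Om *ᵥ v) = Om *ᵥ v
  /-- `P w = 0` -/
  hPw : P *ᵥ w = 0
  /-- `P (Om w) = 0` -/
  hPOw : P *ᵥ (Om *ᵥ w) = 0

variable {k : Type} [Field k] [CharZero k] {R : Type} [CommRing R]

namespace TorusData

variable (D : TorusData k)

/-- the adapted basis of the data -/
def S : Matrix (Fin 4) (Fin 4) k := adaptedBasis D.Om D.v D.w

/-- **the torus element of a pair of scalars** `ρ = (x, y, x′, y′)`, row convention:
`tmat ι D ρ = (S⁻¹)ᵀ · (blockScalar d x y x′ y′)ᵀ · Sᵀ` over `R` -/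
def tmat (ι : k →+* R) (ρ : Fin 4 → R) : Matrix (Fin 4) (Fin 4) R :=
  ((D.S⁻¹).map ι)ᵀ * (blockScalar (ι D.d) (ρ 0) (ρ 1) (ρ 2) (ρ 3))ᵀ * (D.S.map ι)ᵀ

/-- the componentwise product of two pairs of scalars in `R[√−d]²` -/
def pmul (d : R) (ρ ρ' : Fin 4 → R) : Fin 4 → R :=
  ![ρ 0 * ρ' 0 - d * (ρ 1 * ρ' 1), ρ 0 * ρ' 1 + ρ 1 * ρ' 0, ρ 2 * ρ' 2 - d * (ρ 3 * ρ' 3),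
    ρ 2 * ρ' 3 + ρ 3 * ρ' 2]

/-- the conjugate pair `(x, −y, x′, −y′)` -/
def pconj (ρ : Fin 4 → R) : Fin 4 → R := ![ρ 0, -ρ 1, ρ 2, -ρ 3]

/-- the unit pair `(1, 0, 1, 0)` -/
def pone : Fin 4 → R := ![1, 0, 1, 0]

/-- the two norms of a pair are `1` -/
def IsNormOne (d : R) (ρ : Fin 4 → R) : Prop :=
  ρ 0 * ρ 0 + d * (ρ 1 * ρ 1) = 1 ∧ ρ 2 * ρ 2 + d * (ρ 3 * ρ 3) = 1

/-- the set-up facts of the data over `R` -/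
theorem setup (ι : k →+* R) :
    D.S.map ι * (D.S⁻¹).map ι = 1 ∧ (D.S⁻¹).map ι * D.S.map ι = 1 ∧
    D.Om.map ι * D.S.map ι = D.S.map ι * omegaJ (ι D.d) ∧
    D.P.map ι * D.S.map ι = D.S.map ι * projFirst R ∧
    (D.S.map ι)ᵀ * D.B.map ι * D.S.map ι =
      Matrix.diagonal ![ι (D.v ⬝ᵥ (D.B *ᵥ D.v)), ι D.d * ι (D.v ⬝ᵥ (D.B *ᵥ D.v)),
        ι (D.w ⬝ᵥ (D.B *ᵥ D.w)), ι D.d * ι (D.w ⬝ᵥ (D.B *ᵥ D.w))] ∧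
    D.v ⬝ᵥ (D.B *ᵥ D.v) ≠ 0 ∧ D.w ⬝ᵥ (D.B *ᵥ D.w) ≠ 0 ∧ D.d ≠ 0 :=
  adapted_setup ι D.hB D.hherm D.hOm D.hd D.hdef D.hv D.hw D.hwv D.hwOv D.hPv D.hPOv D.hPw D.hPOw

omit [CharZero k] in
/-- `tmat` is the transpose of the conjugated block scalar -/
theorem tmat_eq_transpose (ι : k →+* R) (ρ : Fin 4 → R) :
    D.tmat ι ρ = (D.S.map ι * blockScalar (ι D.d) (ρ 0) (ρ 1) (ρ 2) (ρ 3) * (D.S⁻¹).map ι)ᵀ := by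
  rw [tmat, Matrix.transpose_mul, Matrix.transpose_mul, Matrix.mul_assoc]

/-- **multiplicativity**: `tmat ρ * tmat ρ′ = tmat (ρ ⋆ ρ′)` -/
theorem tmat_mul (ι : k →+* R) (ρ ρ' : Fin 4 → R) :
    D.tmat ι ρ * D.tmat ι ρ' = D.tmat ι (pmul (ι D.d) ρ ρ') := by
  obtain ⟨-, hRR', -, -, -, -, -, -⟩ := D.setup ι
  have h1 : (D.S.map ι)ᵀ * ((D.S⁻¹).map ι)ᵀ = 1 := by
    rw [← Matrix.transpose_mul, hRR', Matrix.transpose_one]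
  have hb := blockScalar_mul (ι D.d) (ρ' 0) (ρ' 1) (ρ' 2) (ρ' 3) (ρ 0) (ρ 1) (ρ 2) (ρ 3)
  have hbT : (blockScalar (ι D.d) (ρ 0) (ρ 1) (ρ 2) (ρ 3))ᵀ *
      (blockScalar (ι D.d) (ρ' 0) (ρ' 1) (ρ' 2) (ρ' 3))ᵀ =
      (blockScalar (ι D.d) (pmul (ι D.d) ρ ρ' 0) (pmul (ι D.d) ρ ρ' 1) (pmul (ι D.d) ρ ρ' 2)
        (pmul (ι D.d) ρ ρ' 3))ᵀ := by
    rw [← Matrix.transpose_mul, hb]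
    congr 1
    simp only [pmul, Matrix.cons_val_zero, Matrix.cons_val_one, Matrix.head_cons, Matrix.cons_val_two,
      Matrix.tail_cons, Matrix.cons_val_three]
    congr 1 <;> ring
  calc D.tmat ι ρ * D.tmat ι ρ'
      = ((D.S⁻¹).map ι)ᵀ * (blockScalar (ι D.d) (ρ 0) (ρ 1) (ρ 2) (ρ 3))ᵀ *
          ((D.S.map ι)ᵀ * ((D.S⁻¹).map ι)ᵀ) *
          (blockScalar (ι D.d) (ρ' 0) (ρ' 1) (ρ' 2) (ρ' 3))ᵀ * (D.S.map ι)ᵀ := by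
        simp only [tmat, Matrix.mul_assoc]
    _ = ((D.S⁻¹).map ι)ᵀ * ((blockScalar (ι D.d) (ρ 0) (ρ 1) (ρ 2) (ρ 3))ᵀ *
          (blockScalar (ι D.d) (ρ' 0) (ρ' 1) (ρ' 2) (ρ' 3))ᵀ) * (D.S.map ι)ᵀ := by
        rw [h1, Matrix.mul_one]
        simp only [Matrix.mul_assoc]
    _ = D.tmat ι (pmul (ι D.d) ρ ρ') := by rw [hbT, tmat]

/-- the unit -/
theorem tmat_one (ι : k →+* R) : D.tmat ι pone = 1 := by
  obtain ⟨hRR, -, -, -, -, -, -, -⟩ := D.setup ι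
  have hb : blockScalar (ι D.d) (pone 0) (pone 1) (pone 2) (pone 3) = (1 : Matrix (Fin 4) (Fin 4) R) := by
    simp only [pone, Matrix.cons_val_zero, Matrix.cons_val_one, Matrix.head_cons, Matrix.cons_val_two,
      Matrix.tail_cons, Matrix.cons_val_three]
    exact blockScalar_one (ι D.d)
  rw [tmat, hb, Matrix.transpose_one, Matrix.mul_one, ← Matrix.transpose_mul, hRR, Matrix.transpose_one]

/-- the product of a pair with its conjugate is the pair of norms -/
theorem pmul_pconj (d : R) (ρ : Fin 4 → R) :
    pmul d ρ (pconj ρ) = ![ρ 0 * ρ 0 + d * (ρ 1 * ρ 1), 0, ρ 2 * ρ 2 + d * (ρ 3 * ρ 3), 0] := by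
  funext i
  fin_cases i <;> simp [pmul, pconj] <;> ring

/-- **the inverse**: for norm-one `ρ`, `tmat ρ * tmat ρ̄ = 1` -/
theorem tmat_mul_pconj (ι : k →+* R) (ρ : Fin 4 → R) (hρ : IsNormOne (ι D.d) ρ) :
    D.tmat ι ρ * D.tmat ι (pconj ρ) = 1 := by
  rw [tmat_mul, pmul_pconj, hρ.1, hρ.2]
  exact D.tmat_one ι

/-- the conjugate of a norm-one pair has norm one -/
theorem isNormOne_pconj (d : R) (ρ : Fin 4 → R) (hρ : IsNormOne d ρ) : IsNormOne d (pconj ρ) := by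
  obtain ⟨h1, h2⟩ := hρ
  refine ⟨?_, ?_⟩
  · simp [pconj]; linear_combination h1
  · simp [pconj]; linear_combination h2

/-- `tmat ρ̄ * tmat ρ = 1` for norm-one `ρ` -/
theorem tmat_pconj_mul (ι : k →+* R) (ρ : Fin 4 → R) (hρ : IsNormOne (ι D.d) ρ) :
    D.tmat ι (pconj ρ) * D.tmat ι ρ = 1 := by
  have h : pconj (pconj ρ) = ρ := by
    funext i
    fin_cases i <;> simp [pconj]
  have := D.tmat_mul_pconj ι (pconj ρ) (isNormOne_pconj _ ρ hρ)
  rwa [h] at this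

/-- the product of norm-one pairs has norm one -/
theorem isNormOne_pmul (d : R) (ρ ρ' : Fin 4 → R) (hρ : IsNormOne d ρ) (hρ' : IsNormOne d ρ') :
    IsNormOne d (pmul d ρ ρ') := by
  obtain ⟨h1, h2⟩ := hρ
  obtain ⟨h1', h2'⟩ := hρ'
  refine ⟨?_, ?_⟩
  · simp only [pmul, Matrix.cons_val_zero, Matrix.cons_val_one]
    linear_combination (ρ' 0 * ρ' 0 + d * (ρ' 1 * ρ' 1)) * h1 + h1'
  · simp only [pmul, Matrix.cons_val_two, Matrix.tail_cons, Matrix.head_cons, Matrix.cons_val_three]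
    linear_combination (ρ' 2 * ρ' 2 + d * (ρ' 3 * ρ' 3)) * h2 + h2'

/-- **the three invariance properties of `tmat ρ` for a norm-one pair** (row picture): commutation with `Omᵀ`,
the isometry identity `tmat B tmatᵀ = B`, and commutation with `Pᵀ`. -/
theorem tmat_props (ι : k →+* R) (ρ : Fin 4 → R) (hρ : IsNormOne (ι D.d) ρ) :
    D.tmat ι ρ * (D.Om.map ι)ᵀ = (D.Om.map ι)ᵀ * D.tmat ι ρ ∧
    D.tmat ι ρ * D.B.map ι * (D.tmat ι ρ)ᵀ = D.B.map ι ∧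
    D.tmat ι ρ * (D.P.map ι)ᵀ = (D.P.map ι)ᵀ * D.tmat ι ρ := by
  obtain ⟨h1, h2, h3⟩ := isometry_of_blockScalar ι D.hB D.hherm D.hOm D.hd D.hdef D.hv D.hw D.hwv D.hwOv
    D.hPv D.hPOv D.hPw D.hPOw (ρ 0) (ρ 1) (ρ 2) (ρ 3) hρ.1 hρ.2
  rw [tmat_eq_transpose]
  refine ⟨?_, ?_, ?_⟩
  · rw [← Matrix.transpose_mul, ← Matrix.transpose_mul]
    exact congrArg Matrix.transpose h1.symm
  · rw [Matrix.transpose_transpose]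
    exact h2
  · rw [← Matrix.transpose_mul, ← Matrix.transpose_mul]
    exact congrArg Matrix.transpose h3.symm

end TorusData

end Summit.Ventures.HodgeRepro.Tier4.Line1.Rot

end
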